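import Summits.Ventures.PercRepro.S1FiveCircuitsSolidFiveBase

/-!
# PercRepro — THE SOLID ANALYSIS, CASE 1 AT NULLITY `5` (PART B): `≤ 28`, AND `s₅ ≤ 90` ON `(13, 6)` MODULO THE TABLE (p1, gen 33)

`proofs/P1-S2-CORANK6.md` §4l addendum 4: `ncard_fiveCircuitsThrough_inter_pair_le_eight` (class (β) `≤ 8`),
**`ncard_fiveCircuitsThrough_le_twenty_eight_of_seven_solid_five`** (`15 + 5 + 8`), `ncard_fiveCircuits_le_ninety_thirteen_six_of_tPoor'`,
`ncard_fourCircuitsThrough_le_choose` (`#4circ(f) ≤ C(ν + 2, 3)`), `tPoor_of_le_two`, and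
**`ncard_fiveCircuits_le_ninety_thirteen_six_of_tPoor_three_four_five`**: `s₅ ≤ 90` on the `(13, 6)` coloop-free spread e-free core modulo the
plane-poor 8-spread table at nullities `3, 4, 5` only. Part A = `S1FiveCircuitsSolidFiveBase`.
Axioms: standard.
-/

open scoped Matroid

namespace PercRepro

namespace S1

open Set

open FourCap

variable {α : Type}
/-- **CLASS (β)**: the five-circuits through `e` meeting the 7-point flat `S₀` in `e` and one more point number at most `8`. -/
theorem ncard_fiveCircuitsThrough_inter_pair_le_eight (M : Matroid α) [M.Finite]
    (hfree : ∀ e ∈ M.E, ∃ A ⊆ M.E \ {e}, e ∉ M.closure A ∧ e ∉ M.closure ((M.E \ {e}) \ A))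
    (hns : ¬ ∃ W ⊆ M.E, W.ncard ≤ 9 ∧ W.encard = M.eRk W + 4) (hd : M.E.encard = M.eRank + 5)
    {X : Set α} (hX4 : M.eRk X = 4) {e : α} (heX : e ∈ M.closure X) (h7 : (M.closure X).ncard = 7) :
    {C : Set α | M.IsCircuit C ∧ C.ncard = 5 ∧ e ∈ C ∧ ¬ C ⊆ M.closure X ∧ ¬ C ∩ M.closure X ⊆ {e}}.ncard ≤ 8 := by
  classical
  have hS₀E : M.closure X ⊆ M.E := M.closure_subset_ground X
  have hS₀f : (M.closure X).Finite := M.ground_finite.subset hS₀E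
  have heE : e ∈ M.E := hS₀E heX
  have hS₀r : M.eRk (M.closure X) = 4 := by rw [M.eRk_closure_eq]; exact hX4
  obtain ⟨I, hI⟩ := M.exists_isBasis (M.closure X) hS₀E
  have hI4 : I.encard = 4 := by rw [hI.encard_eq_eRk, hS₀r]
  have hIf : I.Finite := hS₀f.subset hI.subset
  have hI4' : I.ncard = 4 := by
    have := hI4; rw [← hIf.cast_ncard_eq] at this; exact_mod_cast this
  -- the contraction `K = M ／ S₀`: nullity `2`
  have hK2 := nullity_contract_closure_eq_two M hd hX4 h7
  -- independence in `K`: two distinct points outside `S₀` are independent (a parallel pair would be a rank-`5` set of `9` points)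
  have hindep2 : ∀ u u', u ∈ M.E \ M.closure X → u' ∈ M.E \ M.closure X → u ≠ u' →
      (M ／ M.closure X).Indep {u, u'} := by
    intro u u' hu hu' huu'
    rw [hI.contract_indep_iff]
    refine ⟨?_, disjoint_right.2 (fun x hx => ?_)⟩
    swap
    · rcases mem_insert_iff.1 hx with rfl | hx
      · exact hu.2
      · rw [mem_singleton_iff.1 hx]; exact hu'.2
    · have hdisj : Disjoint ({u, u'} : Set α) I :=
        disjoint_left.2 (fun x hx hxI => by
          rcases mem_insert_iff.1 hx with rfl | hx
          · exact hu.2 (hI.subset hxI)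
          · rw [mem_singleton_iff.1 hx] at hxI; exact hu'.2 (hI.subset hxI))
      have hcard : ({u, u'} ∪ I).ncard = 6 := by
        rw [ncard_union_eq hdisj ((finite_singleton u').insert u) hIf, ncard_pair huu', hI4']
      have hsub : {u, u'} ∪ I ⊆ M.E := union_subset (pair_subset hu.1 hu'.1) (hI.subset.trans hS₀E)
      have hr : M.eRk ({u, u'} ∪ I) = M.eRk ({u, u'} ∪ M.closure X) := by
        rw [union_comm, hI.eRk_eq_eRk_union, union_comm]
      have hr6 : 6 ≤ M.eRk ({u, u'} ∪ I) := by
        by_contra hlt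
        push Not at hlt
        have hle5 : M.eRk ({u, u'} ∪ M.closure X) ≤ 5 := by
          rw [← hr]
          obtain ⟨r, hr'⟩ := exists_eRk_eq_coe M ({u, u'} ∪ I)
          rw [hr'] at hlt ⊢
          have : r < 6 := by exact_mod_cast hlt
          exact_mod_cast (show r ≤ 5 by omega)
        have hcard' : ({u, u'} ∪ M.closure X).ncard = 9 := by
          rw [ncard_union_eq (disjoint_left.2 (fun x hx hxS => by
              rcases mem_insert_iff.1 hx with rfl | hx
              · exact hu.2 hxS
              · rw [mem_singleton_iff.1 hx] at hxS; exact hu'.2 hxS)) ((finite_singleton u').insert u) hS₀f,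
            ncard_pair huu', h7]
        have := S2.ncard_le_of_eRk_le_of_not_nullity M 4 9 (by norm_num) hns
          (union_subset (pair_subset hu.1 hu'.1) hS₀E) (r := 5) (by norm_num) hle5
        omega
      rw [Matroid.indep_iff_eRk_eq_encard_of_finite (((finite_singleton u').insert u).union hIf)]
      apply le_antisymm (M.eRk_le_encard _)
      rw [← ((finite_singleton u').insert u).union hIf |>.cast_ncard_eq, hcard]
      exact_mod_cast hr6
  -- the map `C ↦ C ∖ S₀` into the 3-circuits of `K`
  have hmap : ∀ C ∈ {C : Set α | M.IsCircuit C ∧ C.ncard = 5 ∧ e ∈ C ∧ ¬ C ⊆ M.closure X ∧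
      ¬ C ∩ M.closure X ⊆ {e}}, C \ M.closure X ∈
      {Q : Set α | (M ／ M.closure X).IsCircuit Q ∧ Q.ncard = 2 + 1} := by
    rintro C ⟨hC, h5, heC, hCS, hCe⟩
    have hCf : C.Finite := M.ground_finite.subset hC.subset_ground
    have h2 := ncard_inter_le_two_of_not_subset M hns hX4 h7 hC h5 hCS
    have h2' : 2 ≤ (C ∩ M.closure X).ncard := by
      by_contra hlt
      push Not at hlt
      apply hCe
      have h1 : (C ∩ M.closure X).ncard ≤ 1 := by omega
      rw [ncard_le_one_iff (hCf.subset inter_subset_left)] at h1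
      intro x hx
      rw [mem_singleton_iff]
      exact h1 hx ⟨heC, heX⟩
    have hI2 : (C ∩ M.closure X).ncard = 2 := by omega
    have hQ3 : (C \ M.closure X).ncard = 2 + 1 := by
      have := ncard_inter_add_ncard_sdiff_eq_ncard C (M.closure X) hCf
      omega
    refine ⟨?_, hQ3⟩
    -- `Q` is dependent in `K`: `r(Q ∪ S₀) ≤ 4 + 4 − 2 = 6 < 7 = |Q ∪ I|`
    have hQE : C \ M.closure X ⊆ (M ／ M.closure X).E := by
      rw [Matroid.contract_ground]
      exact sdiff_subset_sdiff_left hC.subset_ground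
    have hdep : (M ／ M.closure X).Dep (C \ M.closure X) := by
      rw [Matroid.dep_iff]
      refine ⟨?_, hQE⟩
      rw [hI.contract_indep_iff]
      rintro ⟨hind, -⟩
      have hIss : C ∩ M.closure X ⊂ C := by
        refine LE.le.ssubset_of_ne inter_subset_left ?_
        intro h
        exact hCS (by rw [← h]; exact inter_subset_right)
      have hIr : M.eRk (C ∩ M.closure X) = 2 := by
        rw [(hC.ssubset_indep hIss).eRk_eq_encard, ← (hCf.subset inter_subset_left).cast_ncard_eq, hI2]
        rfl
      have hsub := M.eRk_inter_add_eRk_union_le (M.closure X) C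
      rw [inter_comm, hIr, hS₀r, eRk_eq_four_of_fiveCircuit M hC h5] at hsub
      have hunion : M.closure X ∪ C = M.closure X ∪ (C \ M.closure X) := by
        rw [union_sdiff_self]
      have hr : M.eRk (C \ M.closure X ∪ I) = M.eRk (M.closure X ∪ C) := by
        rw [union_comm, hI.eRk_eq_eRk_union, ← hunion]
      have hdisj : Disjoint (C \ M.closure X) I :=
        disjoint_left.2 (fun x hx hxI => hx.2 (hI.subset hxI))
      have hcard : (C \ M.closure X ∪ I).ncard = 7 := by
        rw [ncard_union_eq hdisj (hCf.subset sdiff_subset) hIf, hQ3, hI4']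
      have hind' := hind.eRk_eq_encard
      rw [hr, ← ((hCf.subset sdiff_subset).union hIf).cast_ncard_eq, hcard] at hind'
      obtain ⟨r, hr'⟩ := exists_eRk_eq_coe M (M.closure X ∪ C)
      rw [hr'] at hsub hind'
      have h1 : 2 + r ≤ 4 + 4 := by exact_mod_cast hsub
      have h2 : r = 7 := by exact_mod_cast hind'
      omega
    -- and every pair inside `Q` is independent, so `Q` is a circuit
    rw [Matroid.isCircuit_iff_dep_forall_sdiff_singleton_indep]
    refine ⟨hdep, ?_⟩
    intro q hq
    obtain ⟨a, b, c, hab, hac, hbc, hQ⟩ := ncard_eq_three.1 hQ3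
    have hmem : ∀ x ∈ ({a, b, c} : Set α), x ∈ M.E \ M.closure X := fun x hx => by
      rw [← hQ] at hx
      exact ⟨hC.subset_ground hx.1, hx.2⟩
    have haE := hmem a (mem_insert _ _)
    have hbE := hmem b (mem_insert_of_mem _ (mem_insert _ _))
    have hcE := hmem c (mem_insert_of_mem _ (mem_insert_of_mem _ (mem_singleton c)))
    rw [hQ] at hq ⊢
    simp only [mem_insert_iff, mem_singleton_iff] at hq
    rcases hq with rfl | rfl | rfl
    · rw [insert_sdiff_self_of_notMem (by simp [hab, hac])]
      exact hindep2 b c hbE hcE hbc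
    · rw [insert_sdiff_of_notMem _ (by simp [hab]), pair_sdiff_left hbc]
      exact hindep2 a c haE hcE hac
    · rw [insert_sdiff_of_notMem _ (by simp [hac]), pair_sdiff_right hbc]
      exact hindep2 a b haE hbE hab
  -- the fibres: for a 3-circuit `Q` of `K`, the circuits `Q ∪ {e, s}` have `s` on the line `cl(Q ∪ {e}) ∩ S₀`
  have hfib : ∀ Q ∈ {Q : Set α | (M ／ M.closure X).IsCircuit Q ∧ Q.ncard = 2 + 1},
      {C ∈ {C : Set α | M.IsCircuit C ∧ C.ncard = 5 ∧ e ∈ C ∧ ¬ C ⊆ M.closure X ∧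
        ¬ C ∩ M.closure X ⊆ {e}} | C \ M.closure X = Q}.ncard ≤ 2 := by
    rintro Q ⟨hQ, hQ3⟩
    have hQE : Q ⊆ M.E \ M.closure X := by
      have := hQ.subset_ground
      rwa [Matroid.contract_ground] at this
    have hQf : Q.Finite := M.ground_finite.subset (hQE.trans sdiff_subset)
    have hQ3' : Q.ncard = 3 := hQ3
    have heQ : e ∉ Q := fun h => (hQE h).2 heX
    -- the line `L = cl(insert e Q) ∩ S₀` has rank `≤ 2`, hence `≤ 3` points
    set L : Set α := M.closure (insert e Q) ∩ M.closure X with hLdef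
    have hLE : L ⊆ M.E := inter_subset_right.trans hS₀E
    have heL : e ∈ L := ⟨M.subset_closure _ (insert_subset heE (hQE.trans sdiff_subset)) (mem_insert e Q), heX⟩
    have hLr : M.eRk L ≤ 2 := by
      by_contra hgt
      push Not at hgt
      have hF : M.eRk (M.closure (insert e Q)) ≤ 4 := by
        rw [M.eRk_closure_eq]
        calc M.eRk (insert e Q) ≤ (insert e Q).encard := M.eRk_le_encard _
          _ = 4 := by
            rw [← (hQf.insert e).cast_ncard_eq, ncard_insert_of_notMem heQ hQf, hQ3']
            rfl
      have hsub := M.eRk_inter_add_eRk_union_le (M.closure (insert e Q)) (M.closure X)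
      rw [← hLdef, hS₀r] at hsub
      have hr5 : M.eRk (M.closure (insert e Q) ∪ M.closure X) ≤ 5 := by
        obtain ⟨rL, hrL⟩ := exists_eRk_eq_coe M L
        obtain ⟨rF, hrF⟩ := exists_eRk_eq_coe M (M.closure (insert e Q))
        obtain ⟨rU, hrU⟩ := exists_eRk_eq_coe M (M.closure (insert e Q) ∪ M.closure X)
        rw [hrL, hrF, hrU] at hsub
        rw [hrL] at hgt
        rw [hrF] at hF
        rw [hrU]
        have h1 : rL + rU ≤ rF + 4 := by exact_mod_cast hsub
        have h2 : 2 < rL := by exact_mod_cast hgt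
        have h3 : rF ≤ 4 := by exact_mod_cast hF
        exact_mod_cast (show rU ≤ 5 by omega)
      have hbig : 10 ≤ (M.closure (insert e Q) ∪ M.closure X).ncard := by
        have hsub' : Q ∪ M.closure X ⊆ M.closure (insert e Q) ∪ M.closure X :=
          union_subset_union_left _ ((subset_insert e Q).trans (M.subset_closure _ (insert_subset heE (hQE.trans sdiff_subset))))
        have hdisj : Disjoint Q (M.closure X) := disjoint_left.2 (fun x hx => (hQE hx).2)
        have := ncard_le_ncard hsub' (M.ground_finite.subset (union_subset (M.closure_subset_ground _) hS₀E))
        rw [ncard_union_eq hdisj hQf hS₀f, hQ3', h7] at this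
        exact this
      have := S2.ncard_le_of_eRk_le_of_not_nullity M 4 9 (by norm_num) hns
        (union_subset (M.closure_subset_ground _) hS₀E) (r := 5) (by norm_num) hr5
      omega
    have hL3 : L.ncard ≤ 3 := ncard_le_three_of_eRk_le_two_of_hfree M hfree hLE heL hLr
    have hLe : (L \ {e}).ncard ≤ 2 := by
      rw [ncard_sdiff_singleton_of_mem heL]
      omega
    -- inject `C ↦ C ∖ insert e Q` into the 1-subsets of `L ∖ {e}`
    have hLef : (L \ {e}).Finite := (M.ground_finite.subset hLE).subset sdiff_subset
    rw [← Nat.choose_one_right (L \ {e}).ncard, ← ncard_setOf_subset_ncard_eq' hLef 1] at hLe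
    refine le_trans (ncard_le_ncard_of_injOn (fun C => C \ insert e Q) ?_ ?_
      (hLef.finite_subsets.subset (fun A hA => hA.1))) hLe
    · rintro C ⟨⟨hC, h5, heC, hCS, hCe⟩, hCQ⟩
      have hCf : C.Finite := M.ground_finite.subset hC.subset_ground
      have hQC : insert e Q ⊆ C := insert_subset heC (by rw [← hCQ]; exact sdiff_subset)
      refine ⟨?_, ?_⟩
      · intro x hx
        have hxS : x ∈ M.closure X := by
          by_contra hxS
          exact hx.2 (mem_insert_of_mem _ (by rw [← hCQ]; exact ⟨hx.1, hxS⟩))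
        have hxe : x ≠ e := fun h => hx.2 (h ▸ mem_insert e Q)
        refine ⟨⟨?_, hxS⟩, hxe⟩
        -- `x ∈ cl(insert e Q)`: `C = insert x (insert e Q)` is a circuit, so `x ∈ cl(C ∖ {x})`
        have hCx : C \ {x} = insert e Q := by
          apply Subset.antisymm
          · intro y hy
            by_contra hyQ
            -- then `y, x ∈ C ∖ insert e Q`, two points, but `C ∖ insert e Q` has one point
            have hsz : (C \ insert e Q).ncard = 1 := by
              rw [ncard_sdiff' hQC hCf, h5, ncard_insert_of_notMem heQ hQf, hQ3']
            rw [ncard_eq_one] at hsz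
            obtain ⟨z, hz⟩ := hsz
            have hy' : y ∈ C \ insert e Q := ⟨hy.1, hyQ⟩
            have hx' : x ∈ C \ insert e Q := hx
            rw [hz, mem_singleton_iff] at hy' hx'
            exact hy.2 (mem_singleton_iff.2 (hy'.trans hx'.symm))
          · exact subset_sdiff.2 ⟨hQC, disjoint_singleton_right.2 hx.2⟩
        have := hC.mem_closure_sdiff_singleton_of_mem hx.1
        rwa [hCx] at this
      · rw [ncard_sdiff' hQC hCf, h5, ncard_insert_of_notMem heQ hQf, hQ3']
    · rintro C ⟨⟨hC, h5, heC, hCS, hCe⟩, hCQ⟩ C' ⟨⟨hC', h5', heC', hC'S, hC'e⟩, hC'Q⟩ h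
      simp only at h
      have hQC : insert e Q ⊆ C := insert_subset heC (by rw [← hCQ]; exact sdiff_subset)
      have hQC' : insert e Q ⊆ C' := insert_subset heC' (by rw [← hC'Q]; exact sdiff_subset)
      rw [← union_sdiff_cancel hQC, ← union_sdiff_cancel hQC', h]
  -- assemble
  have hsfin : {C : Set α | M.IsCircuit C ∧ C.ncard = 5 ∧ e ∈ C ∧ ¬ C ⊆ M.closure X ∧
      ¬ C ∩ M.closure X ⊆ {e}}.Finite :=
    M.ground_finite.finite_subsets.subset (fun C hC => hC.1.subset_ground)
  have htfin : {Q : Set α | (M ／ M.closure X).IsCircuit Q ∧ Q.ncard = 2 + 1}.Finite :=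
    (M ／ M.closure X).ground_finite.finite_subsets.subset (fun Q hQ => hQ.1.subset_ground)
  calc {C : Set α | M.IsCircuit C ∧ C.ncard = 5 ∧ e ∈ C ∧ ¬ C ⊆ M.closure X ∧ ¬ C ∩ M.closure X ⊆ {e}}.ncard
      ≤ 2 * {Q : Set α | (M ／ M.closure X).IsCircuit Q ∧ Q.ncard = 2 + 1}.ncard :=
        ncard_le_mul_ncard_of_fibres hsfin htfin (fun C => C \ M.closure X) hmap 2 hfib
    _ ≤ 2 * (2 + 2).choose (2 + 1) :=
        Nat.mul_le_mul_left 2 (PercRepro.Matroid.ncard_circuits_le_choose_of_encard (M ／ M.closure X) hK2 2)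
    _ = 8 := by decide

/-- **CASE 1 AT NULLITY `5`**: on a spread e-free core of nullity `5`, if some rank-`4` flat `cl(X)` through `e` has `7` points, then
at most `28` five-circuits pass through `e` (`15` inside, `≤ 5` of class (α), `≤ 8` of class (β)). -/
theorem ncard_fiveCircuitsThrough_le_twenty_eight_of_seven_solid_five (M : Matroid α) [M.Finite]
    (hfree : ∀ e ∈ M.E, ∃ A ⊆ M.E \ {e}, e ∉ M.closure A ∧ e ∉ M.closure ((M.E \ {e}) \ A))
    (hns : ¬ ∃ W ⊆ M.E, W.ncard ≤ 9 ∧ W.encard = M.eRk W + 4) (hd : M.E.encard = M.eRank + 5)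
    {e : α} {X : Set α} (hX4 : M.eRk X = 4) (heX : e ∈ M.closure X) (h7 : (M.closure X).ncard = 7) :
    {C : Set α | M.IsCircuit C ∧ C.ncard = 5 ∧ e ∈ C}.ncard ≤ 28 := by
  classical
  have hS₀E : M.closure X ⊆ M.E := M.closure_subset_ground X
  have hS₀e : (M.closure X \ {e}).ncard = 6 := by rw [ncard_sdiff_singleton_of_mem heX, h7]
  have hfinsub : ∀ s : Set (Set α), (∀ C ∈ s, M.IsCircuit C) → s.Finite := fun s hs =>
    M.ground_finite.finite_subsets.subset (fun C hC => (hs C hC).subset_ground)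
  have hsplit : {C : Set α | M.IsCircuit C ∧ C.ncard = 5 ∧ e ∈ C} ⊆
      ({C : Set α | M.IsCircuit C ∧ C.ncard = 5 ∧ e ∈ C ∧ C ⊆ M.closure X} ∪
        {C : Set α | M.IsCircuit C ∧ C.ncard = 5 ∧ e ∈ C ∧ C ∩ M.closure X ⊆ {e}}) ∪
        {C : Set α | M.IsCircuit C ∧ C.ncard = 5 ∧ e ∈ C ∧ ¬ C ⊆ M.closure X ∧ ¬ C ∩ M.closure X ⊆ {e}} := by
    intro C hC
    by_cases h1 : C ⊆ M.closure X
    · exact Or.inl (Or.inl ⟨hC.1, hC.2.1, hC.2.2, h1⟩)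
    by_cases h2 : C ∩ M.closure X ⊆ {e}
    · exact Or.inl (Or.inr ⟨hC.1, hC.2.1, hC.2.2, h2⟩)
    · exact Or.inr ⟨hC.1, hC.2.1, hC.2.2, h1, h2⟩
  have hin15 : {C : Set α | M.IsCircuit C ∧ C.ncard = 5 ∧ e ∈ C ∧ C ⊆ M.closure X}.ncard ≤ 15 := by
    have := ncard_fiveCircuitsThrough_subset_le_choose M hS₀E e
    rw [hS₀e] at this
    exact this.trans (le_of_eq (by decide))
  have hα := ncard_fiveCircuitsThrough_inter_subset_le_five M hfree hd hX4 heX h7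
  have hβ := ncard_fiveCircuitsThrough_inter_pair_le_eight M hfree hns hd hX4 heX h7
  have h1 := ncard_le_ncard hsplit (((hfinsub _ (fun C hC => hC.1)).union (hfinsub _ (fun C hC => hC.1))).union
    (hfinsub _ (fun C hC => hC.1)))
  have h2 := ncard_union_le ({C : Set α | M.IsCircuit C ∧ C.ncard = 5 ∧ e ∈ C ∧ C ⊆ M.closure X} ∪
    {C : Set α | M.IsCircuit C ∧ C.ncard = 5 ∧ e ∈ C ∧ C ∩ M.closure X ⊆ {e}})
    {C : Set α | M.IsCircuit C ∧ C.ncard = 5 ∧ e ∈ C ∧ ¬ C ⊆ M.closure X ∧ ¬ C ∩ M.closure X ⊆ {e}}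
  have h3 := ncard_union_le {C : Set α | M.IsCircuit C ∧ C.ncard = 5 ∧ e ∈ C ∧ C ⊆ M.closure X}
    {C : Set α | M.IsCircuit C ∧ C.ncard = 5 ∧ e ∈ C ∧ C ∩ M.closure X ⊆ {e}}
  omega

/-- **`s₅ ≤ 90` ON THE `(13, 6)` CORE MODULO THE PLANE-POOR TABLE ALONE** — fact (b) discharged by Case 1 at nullity `5`. -/
theorem ncard_fiveCircuits_le_ninety_thirteen_six_of_tPoor' (M : Matroid α) [M.Finite]
    (hfree : ∀ e ∈ M.E, ∃ A ⊆ M.E \ {e}, e ∉ M.closure A ∧ e ∉ M.closure ((M.E \ {e}) \ A))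
    (hns : ¬ ∃ W ⊆ M.E, W.ncard ≤ 9 ∧ W.encard = M.eRk W + 4) (hd : M.E.encard = M.eRank + 6)
    (hn : M.E.ncard = 19) (hK : ∀ e, ¬ M.IsColoop e)
    (ht : ∀ (N' : Matroid α) [N'.Finite], PlanePoor N' → Spread8 N' → ∀ j : ℕ, N'.E.encard = N'.eRank + j → ∀ f ∈ N'.E,
      {D : Set α | N'.IsCircuit D ∧ D.ncard = 4 ∧ f ∈ D}.ncard ≤ tPoor j) :
    {C : Set α | M.IsCircuit C ∧ C.ncard = 5}.ncard ≤ 90 :=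
  ncard_fiveCircuits_le_ninety_thirteen_six_of_tPoor M hfree hns hd hn hK ht
    (fun M' _ hfree' hns' hd' _ _ hX4 heX h7 =>
      ncard_fiveCircuitsThrough_le_twenty_eight_of_seven_solid_five M' hfree' hns' hd' hX4 heX h7)

/-- **The four-circuits through a point number at most `C(ν + 2, 3)`** on every finite matroid of nullity `ν` (contract the point:
`D ↦ D ∖ {f}` injects into the 3-circuits of `M ／ {f}`, which has the same nullity; the landed `ncard_circuits_le_choose_of_encard`). -/
theorem ncard_fourCircuitsThrough_le_choose (M : Matroid α) [M.Finite] {d : ℕ} (hd : M.E.encard = M.eRank + d) (f : α) :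
    {D : Set α | M.IsCircuit D ∧ D.ncard = 4 ∧ f ∈ D}.ncard ≤ (d + 2).choose 3 := by
  classical
  by_cases hempty : {D : Set α | M.IsCircuit D ∧ D.ncard = 4 ∧ f ∈ D} = ∅
  · rw [hempty, ncard_empty]; exact Nat.zero_le _
  obtain ⟨D₀, hD₀⟩ := nonempty_iff_ne_empty.2 hempty
  have hfE : f ∈ M.E := hD₀.1.subset_ground hD₀.2.2
  have hfl : ¬ M.IsLoop f := by
    intro hl
    have h4 := hD₀.2.1
    rw [hl.eq_of_isCircuit_mem hD₀.1 hD₀.2.2, ncard_singleton] at h4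
    exact absurd h4 (by norm_num)
  have hdN := nullity_contract_singleton_of_not_isLoop M hfE hfl hd
  have hfin : {D : Set α | (M ／ {f}).IsCircuit D ∧ D.ncard = 2 + 1}.Finite :=
    (M ／ {f}).ground_finite.finite_subsets.subset (fun D hD => hD.1.subset_ground)
  calc {D : Set α | M.IsCircuit D ∧ D.ncard = 4 ∧ f ∈ D}.ncard
      ≤ {D : Set α | (M ／ {f}).IsCircuit D ∧ D.ncard = 2 + 1}.ncard := by
        refine Set.ncard_le_ncard_of_injOn (fun D : Set α => D \ {f}) ?_ ?_ hfin
        · rintro D ⟨hD, h4, hfD⟩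
          have hDfin : D.Finite := M.ground_finite.subset hD.subset_ground
          have hnt : D.Nontrivial := by
            have : Finite D := hDfin.to_subtype
            rw [← Set.one_lt_ncard_iff_nontrivial, h4]; norm_num
          refine ⟨hD.contractElem_isCircuit hnt hfD, ?_⟩
          rw [Set.ncard_sdiff_singleton_of_mem hfD, h4]
        · rintro D ⟨-, -, hfD⟩ D' ⟨-, -, hfD'⟩ h
          simp only at h
          have h1 : D = insert f (D \ {f}) := by rw [Set.insert_sdiff_singleton, Set.insert_eq_of_mem hfD]
          have h2 : D' = insert f (D' \ {f}) := by rw [Set.insert_sdiff_singleton, Set.insert_eq_of_mem hfD']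
          rw [h1, h2, h]
    _ ≤ (d + 2).choose (2 + 1) := PercRepro.Matroid.ncard_circuits_le_choose_of_encard (M ／ {f}) hdN 2

/-- **The plane-poor table at nullity `≤ 2` is free**: `tPoor j = C(j + 2, 3)` there (`0, 1, 4`). -/
theorem tPoor_of_le_two (N : Matroid α) [N.Finite] {j : ℕ} (hj : j ≤ 2) (hd : N.E.encard = N.eRank + j) (f : α) :
    {D : Set α | N.IsCircuit D ∧ D.ncard = 4 ∧ f ∈ D}.ncard ≤ tPoor j := by
  refine (ncard_fourCircuitsThrough_le_choose N hd f).trans (le_of_eq ?_)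
  interval_cases j <;> decide

/-- **`s₅ ≤ 90` ON THE `(13, 6)` CORE MODULO THE PLANE-POOR TABLE AT NULLITIES `3, 4, 5` ONLY** (`t(3) = 5`, `t(4) = 8`, `t(5) = 9`, on the plane-poor 8-spread class). -/
theorem ncard_fiveCircuits_le_ninety_thirteen_six_of_tPoor_three_four_five (M : Matroid α) [M.Finite]
    (hfree : ∀ e ∈ M.E, ∃ A ⊆ M.E \ {e}, e ∉ M.closure A ∧ e ∉ M.closure ((M.E \ {e}) \ A))
    (hns : ¬ ∃ W ⊆ M.E, W.ncard ≤ 9 ∧ W.encard = M.eRk W + 4) (hd : M.E.encard = M.eRank + 6)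
    (hn : M.E.ncard = 19) (hK : ∀ e, ¬ M.IsColoop e)
    (ht : ∀ (N' : Matroid α) [N'.Finite], PlanePoor N' → Spread8 N' → ∀ j : ℕ, 3 ≤ j → j ≤ 5 → N'.E.encard = N'.eRank + j →
      ∀ f ∈ N'.E, {D : Set α | N'.IsCircuit D ∧ D.ncard = 4 ∧ f ∈ D}.ncard ≤ tPoor j) :
    {C : Set α | M.IsCircuit C ∧ C.ncard = 5}.ncard ≤ 90 := by
  refine ncard_fiveCircuits_le_ninety_thirteen_six_of_tPoor' M hfree hns hd hn hK ?_
  intro N' _ hN' hN8 j hj f hf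
  by_cases hj2 : j ≤ 2
  · exact tPoor_of_le_two N' hj2 hj f
  by_cases hj5 : j ≤ 5
  · exact ht N' hN' hN8 j (by omega) hj5 hj f hf
  · -- beyond nullity `5` the table is the plain bound `C(j + 2, 3)`
    refine (ncard_fourCircuitsThrough_le_choose N' hj f).trans (le_of_eq ?_)
    simp only [tPoor]
    have h0 : j ≠ 0 := by omega
    have h1 : j ≠ 1 := by omega
    have h2 : j ≠ 2 := by omega
    have h3 : j ≠ 3 := by omega
    have h4 : j ≠ 4 := by omega
    have h5 : j ≠ 5 := by omega
    simp [h0, h1, h2, h3, h4, h5]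

end S1

end PercRepro
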